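import Summits.ResolutionOfSingularities.ResolutionOfSingularities.Theorems.EquisingularLiftEquisingularLiftNatTransversalHasSNCWithOfTrace
import Summits.ResolutionOfSingularities.ResolutionOfSingularities.Theorems.EquisingularLiftEquisingularLiftNatTransversalStrictTransformTraceSlim
import Summits.ResolutionOfSingularities.ResolutionOfSingularities.Theorems.EquisingularLiftEquisingularLiftNatCarrierPairStrictTransformRegular
import Summits.ResolutionOfSingularities.ResolutionOfSingularities.Theorems.EquisingularLiftEquisingularLiftNatStrictTransformFlat
import Summits.ResolutionOfSingularities.ResolutionOfSingularities.Theorems.EquisingularLiftEquisingularLiftNatSubchainSupplierInvSLDefs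
import Summits.ResolutionOfSingularities.ResolutionOfSingularities.Theorems.EquisingularLiftEquisingularLiftNatKeyLetterIncidence
import Literature.AlgebraicGeometry.Resolution.StalkIdealGenerization
import Literature.AlgebraicGeometry.Resolution.StrictNormalCrossingsFlatDescent
import Literature.AlgebraicGeometry.Resolution.SncStrata
import Literature.AlgebraicGeometry.Resolution.EtaleVanishingIdeal
import Literature.AlgebraicGeometry.Resolution.SNCStrataSmooth
import Literature.AlgebraicGeometry.Resolution.RegularLocalRingsProofs
import Literature.AlgebraicGeometry.Resolution.MarkedIdealsArithmetic
import HarnessLib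

/-!
# [OURS · L1 W4.5(b) · EL♮(3) · WIDTH TABLE D5 «IMMATURE HOST», supplier row HPAIR, input (CL)] A CROSSED LETTER STEPS TO ITS STRICT TRANSFORM
# `TCPlus.crossedLetter_transport k : <(CL) of ✓ TCPlus.hpair_supplier_of (p670305), verbatim>` over the explicit-model twin `TCPlus.crossedLetter_clauses`

res-L1-w45b-stub-4 g12 (desk R54: «stub-4 = G1 ×2 + crossed-letter lemma»; res-L1-w45b-stub-2 g16 INPUT SPEC (IN-4)).  OURS; NOT a statement of any manuscript
([Hironaka2017] is a candidate under adjudication, nothing of it is asserted); AI-written, weaker than expert review.  No `sorry`; standard axioms;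
DEF-FREE.  `--supports stmt-ResolutionOfSingularities-20148 --as helper`.

WHAT.  In a model square `jG : G ⟶ X` over `Spec θ` (`O` a DVR, `θ : O ↠ k`; `X` regular, proper over `O`), let the round's centre `C` be regular, `O`-flat,
`≠ ⊥`, with REDUCED trace `C·𝒪_G = 𝓘⟨Z⟩`, the reduced curve `Z̃ ⊆ G` regular with one-dimensional local rings at its closed points; `τ = Bl_C`, `υ₂ = Bl_Z`, new
model square `j₂` (`j₂ ≫ τ = υ₂ ≫ jG`).  A LETTER `L` with model `𝓛` (reduced trace `𝓘⟨cl L⟩`, principal stalks, `V(𝓛)` regular, off `Y`, `O`-flat) which is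
CROSSED by the centre — downstairs `𝓘⟨cl L⟩ ⊔ 𝓘⟨Z⟩ = 𝓘⟨cl L ∩ Z⟩` (reduced crossing) and `𝓘⟨cl L⟩_z ⊄ 𝓘⟨Z⟩_z` at every closed `z ∈ Z` (no branch of `Z`
inside `cl L`; possibly `Z ∩ cl L = ∅`) — steps to the letter `closure υ₂⁻¹(cl L ∖ Z)` of the new stage with model the STRICT TRANSFORM `St_C 𝓛`:
* `TCPlus.crossedLetter_clauses` — the five `LetterDatum` clauses for `strictTransformIdeal τ C 𝓛` (explicit-model twin, (IN-4) of res-L1-w45b-stub-2's spec);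
* `TCPlus.crossedLetter_transport k` — the (CL) hypothesis of ✓ `TCPlus.hpair_supplier_of`, VERBATIM (its unused binders — the 2-frames, `C` off `Y`, `G`
  regular along `Z`, integrality of `G`/`X₂` — are ignored).

PROOF (pure composition of tree theorems + ONE downstairs bridge).
(l-iii) `V(St_C 𝓛)` regular: ✓ (A′-1) v2 `hasSNCWith_member_centre_of_trace_transversal` (res-L1-w45b-lead-2, p608670) gives `HasSNCWith [𝓛] C` from the
STALKWISE crossing conditions (T1) `𝓘⟨Z⟩_g ⊔ 𝓘⟨cl L⟩_g = 𝔪_g`, (T2) `𝓘⟨Z⟩_g ≠ 𝔪_g` at every `g ∈ Z ∩ cl L`, then ✓ (A′-2) `isRegular_subscheme_strictTransformIdeal_of_hasSNCWith`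
(res-L1-w45b-stub-4 g10, p606871); (l-i) the trace `𝓘⟨closure υ₂⁻¹(cl L ∖ Z)⟩`: ✓ (A′-3) slim `comap_strictTransformIdeal_eq_vanishingIdeal_of_transversal'`
(res-L1-w45b-stub-2 g12) from the same (T1)/(T2); (l-ii) ✓ `isPrincipal_stalkIdeal_strictTransformIdeal`; (l-iv) ✓ `apply_mem_support_of_mem_support_strictTransformIdeal`;
(l-v) ✓ `flat_strictTransform_subschemeι_comp_stage`.  THE BRIDGE `crossing_stalkwise_of_curve_trace` ((CL)'s downstairs clauses ⟹ (T1)/(T2) at EVERY point of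
`Z ∩ cl L`): at a CLOSED `g`, `𝒪_{G,g}/𝓘⟨Z⟩_g = 𝒪_{Z̃,g}` is a one-dimensional regular local ring, hence a domain of dimension `≤ 1`; the image of `𝓘⟨cl L⟩_g` in it
is non-zero, so every prime containing `𝓘⟨Z⟩_g ⊔ 𝓘⟨cl L⟩_g` is `𝔪_g` (`sup_eq_maximalIdeal_of_isRadical_of_not_le`), and this sum IS radical (it is `𝓘⟨cl L ∩ Z⟩_g`)
⟹ (T1); dimension one ⟹ (T2); a NON-closed `g ∈ Z ∩ cl L` cannot exist: a closed specialisation `z` of `g` (quasi-compactness) lies in `Z ∩ cl L`, the prime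
`𝔭_g ⊆ 𝒪_{G,z}` contains `𝓘⟨Z⟩_z ⊔ 𝓘⟨cl L⟩_z = 𝔪_z` (Literature `stalkIdeal_vanishingIdeal_le`), so `z ⤳ g` (Literature `specializes_of_primeOfSpecializes_le`,
Stacks 01J7) and `g = z`.  The degenerate model `𝓛 = ⊥` (forced: `Z = ∅`, `cl L = G`) is served by `strictTransformIdeal_bot` (`St_C ⊥ = ⊥`, cancellation of the
effective Cartier exceptional factor) and the regularity of `X₂`.  No dimension formula along the chain (T-DIM) is used.
[cite: Matsumura1987, Thm. 14.2] [cite: StacksProject, Tag 01J7] [cite: GortzWedhorn2020, Prop. 13.91 and (13.19)] [folklore; pure composition of the cited tree theorems]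
-/

set_option linter.dupNamespace false -- mandated namespace `Summit.<Summit>.<Problem>` of this single-conjunct summit
set_option linter.overlappingInstances false -- signatures carry `[IsDomain O] [IsDiscreteValuationRing O]`

noncomputable section

open CategoryTheory CategoryTheory.Limits AlgebraicGeometry TopologicalSpace Topology IsLocalRing
open Literature.AlgebraicGeometry.Resolution
open AlgebraicGeometry.Scheme.IdealSheafData

namespace Summit.ResolutionOfSingularities.ResolutionOfSingularities.Cruxes.EquisingularLiftNat.Sections

/-! ## Local algebra -/

/-- **In a local ring `R`, for an ideal `I` with `R ⧸ I` a domain of dimension `≤ 1` and an ideal `J ⊄ I`: if `I ⊔ J` is radical and proper, then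
`I ⊔ J = 𝔪_R`.**  Every prime `𝔭 ⊇ I ⊔ J` maps to a NON-ZERO prime of the one-dimensional domain `R ⧸ I` (non-zero because `J ⊄ I`), hence to its maximal
ideal, so `𝔭 = 𝔪_R`; a radical ideal is the intersection of the primes above it. [cite: Matsumura1987, §5 (dimension) with Thm. 1.1] [folklore] -/
theorem sup_eq_maximalIdeal_of_isRadical_of_not_le {R : Type*} [CommRing R] [IsLocalRing R] {I J : Ideal R}
    [IsDomain (R ⧸ I)] (hdim : ringKrullDim (R ⧸ I) ≤ 1) (hJI : ¬ J ≤ I) (hrad : (I ⊔ J).IsRadical) (hne : I ⊔ J ≠ ⊤) :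
    I ⊔ J = maximalIdeal R := by
  haveI : Ring.KrullDimLE 1 (R ⧸ I) := Ring.krullDimLE_iff.mpr hdim
  refine le_antisymm (IsLocalRing.le_maximalIdeal hne) ?_
  rw [← hrad.radical, Ideal.radical_eq_sInf]
  refine le_sInf ?_
  rintro p ⟨hKp, hp⟩
  have hIp : I ≤ p := le_sup_left.trans hKp
  have hker : RingHom.ker (Ideal.Quotient.mk I) ≤ p := by rw [Ideal.mk_ker]; exact hIp
  haveI := hp
  haveI hp' : (p.map (Ideal.Quotient.mk I)).IsPrime := Ideal.map_isPrime_of_surjective Ideal.Quotient.mk_surjective hker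
  have hne' : p.map (Ideal.Quotient.mk I) ≠ ⊥ := by
    intro h
    rw [Ideal.map_eq_bot_iff_le_ker, Ideal.mk_ker] at h
    exact hJI (le_sup_right.trans (hKp.trans h))
  haveI hmax' : (p.map (Ideal.Quotient.mk I)).IsMaximal := hp'.isMaximal_of_ne_bot hne'
  have hmax : p.IsMaximal := by
    have h := Ideal.comap_isMaximal_of_surjective (Ideal.Quotient.mk I) Ideal.Quotient.mk_surjective (K := p.map (Ideal.Quotient.mk I))
    rwa [Ideal.comap_map_of_surjective _ Ideal.Quotient.mk_surjective, ← RingHom.ker_eq_comap_bot, Ideal.mk_ker,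
      sup_eq_left.mpr hIp] at h
  rw [IsLocalRing.eq_maximalIdeal hmax]

/-- If `R ⧸ I` has Krull dimension one then `I ≠ 𝔪_R` (the residue field has dimension zero). [folklore] -/
theorem ne_maximalIdeal_of_ringKrullDim_quotient_eq_one {R : Type*} [CommRing R] [IsLocalRing R] {I : Ideal R}
    (hdim : ringKrullDim (R ⧸ I) = 1) : I ≠ maximalIdeal R := by
  rintro rfl
  have hf : IsField (R ⧸ maximalIdeal R) := (Ideal.Quotient.maximal_ideal_iff_isField_quotient _).mp inferInstance
  rw [ringKrullDim_eq_zero_of_isField hf] at hdim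
  exact zero_ne_one hdim

/-! ## The strict transform of the zero ideal sheaf -/

/-- Under any blow-up the strict transform of the zero ideal sheaf is zero: `⋃ₙ (0 : 𝓔ⁿ) = 0`, the exceptional ideal `𝓔` being an effective Cartier divisor
(cancellation `(𝓔ⁿ·𝓐 : 𝓔ⁿ) = 𝓐`, Literature `colon_pow_mul_eq`). [cite: GortzWedhorn2020, (13.19)] [folklore] -/
theorem strictTransformIdeal_bot {X X' : Scheme.{0}} [IsLocallyNoetherian X'] {τ : X' ⟶ X} {C : X.IdealSheafData} (hτ : IsBlowup τ C) :
    strictTransformIdeal τ C (⊥ : X.IdealSheafData) = ⊥ := by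
  refine le_antisymm ?_ bot_le
  refine iSup_le fun n => ?_
  rw [Scheme.IdealSheafData.comap_bot, ← Scheme.IdealSheafData.mul_bot ((C.comap τ) ^ n), colon_pow_mul_eq hτ.isEffectiveCartier ⊥ n]
  exact bot_le

/-! ## The downstairs bridge: (CL)'s clauses ⟹ the stalkwise crossing conditions (T1)/(T2) -/

/-- **THE BRIDGE.**  `G` locally Noetherian and quasi-compact; `Z, F ⊆ G` closed; the reduced curve `Z̃ = V(𝓘⟨Z⟩)` regular with one-dimensional
local rings at its closed points; the REDUCED CROSSING `𝓘⟨F⟩ ⊔ 𝓘⟨Z⟩ = 𝓘⟨F ∩ Z⟩`; and NO BRANCH of `Z` inside `F`: `𝓘⟨F⟩_z ⊄ 𝓘⟨Z⟩_z` at every closed `z ∈ Z`.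
Then at EVERY `g ∈ Z ∩ F`: (T1) `𝓘⟨Z⟩_g ⊔ 𝓘⟨F⟩_g = 𝔪_{G,g}` and (T2) `𝓘⟨Z⟩_g ≠ 𝔪_{G,g}` — and every such `g` is a closed point.  See the module docstring.
[cite: StacksProject, Tag 01J7] [cite: Matsumura1987, Thm. 14.2] [OURS · L1 W4.5b · WIDTH TABLE D5, supplier row HPAIR (CL), bridge] -/
theorem crossing_stalkwise_of_curve_trace {G : Scheme.{0}} [IsLocallyNoetherian G] [CompactSpace G] {Z F : Set G} (hZ : IsClosed Z) (hF : IsClosed F)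
    (hZreg : ∀ z : ↥(vanishingIdeal (⟨Z, hZ⟩ : Closeds G)).subscheme, IsRegularLocalRing ((vanishingIdeal (⟨Z, hZ⟩ : Closeds G)).subscheme.presheaf.stalk z))
    (hZdim : ∀ z : ↥(vanishingIdeal (⟨Z, hZ⟩ : Closeds G)).subscheme, IsClosed ({z} : Set ↥(vanishingIdeal (⟨Z, hZ⟩ : Closeds G)).subscheme) →
      ringKrullDim ((vanishingIdeal (⟨Z, hZ⟩ : Closeds G)).subscheme.presheaf.stalk z) = ((1 : ℕ) : WithBot ℕ∞))
    (htr : vanishingIdeal (⟨F, hF⟩ : Closeds G) ⊔ vanishingIdeal (⟨Z, hZ⟩ : Closeds G) = vanishingIdeal (⟨F ∩ Z, hF.inter hZ⟩ : Closeds G))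
    (hnc : ∀ z ∈ Z, IsClosed ({z} : Set G) →
      ¬ stalkIdeal (vanishingIdeal (⟨F, hF⟩ : Closeds G)) z ≤ stalkIdeal (vanishingIdeal (⟨Z, hZ⟩ : Closeds G)) z) :
    (∀ g ∈ Z ∩ F, stalkIdeal (vanishingIdeal (⟨Z, hZ⟩ : Closeds G)) g ⊔ stalkIdeal (vanishingIdeal (⟨F, hF⟩ : Closeds G)) g =
        maximalIdeal (G.presheaf.stalk g)) ∧
      (∀ g ∈ Z ∩ F, stalkIdeal (vanishingIdeal (⟨Z, hZ⟩ : Closeds G)) g ≠ maximalIdeal (G.presheaf.stalk g)) ∧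
      (∀ g ∈ Z ∩ F, IsClosed ({g} : Set G)) := by
  classical
  -- (A) at the CLOSED crossing points
  have key : ∀ g ∈ Z ∩ F, IsClosed ({g} : Set G) →
      stalkIdeal (vanishingIdeal (⟨Z, hZ⟩ : Closeds G)) g ⊔ stalkIdeal (vanishingIdeal (⟨F, hF⟩ : Closeds G)) g =
          maximalIdeal (G.presheaf.stalk g) ∧
        stalkIdeal (vanishingIdeal (⟨Z, hZ⟩ : Closeds G)) g ≠ maximalIdeal (G.presheaf.stalk g) := by
    rintro g ⟨hgZ, hgF⟩ hgcl
    have hgsupp : g ∈ ((vanishingIdeal (⟨Z, hZ⟩ : Closeds G) : G.IdealSheafData).support : Set G) := by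
      rw [Scheme.IdealSheafData.coe_support_vanishingIdeal]; exact hgZ
    obtain ⟨s, hs⟩ : g ∈ Set.range (vanishingIdeal (⟨Z, hZ⟩ : Closeds G)).subschemeι := by
      rw [Scheme.IdealSheafData.range_subschemeι]; exact hgsupp
    subst hs
    have hsc : IsClosed ({s} : Set ↥(vanishingIdeal (⟨Z, hZ⟩ : Closeds G)).subscheme) := by
      have h1 : ({s} : Set ↥(vanishingIdeal (⟨Z, hZ⟩ : Closeds G)).subscheme) =
          (vanishingIdeal (⟨Z, hZ⟩ : Closeds G)).subschemeι ⁻¹' {(vanishingIdeal (⟨Z, hZ⟩ : Closeds G)).subschemeι s} := by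
        ext s'
        simp only [Set.mem_singleton_iff, Set.mem_preimage]
        exact ⟨fun h => by rw [h], fun h => (vanishingIdeal (⟨Z, hZ⟩ : Closeds G)).subschemeι.isClosedEmbedding.injective h⟩
      rw [h1]; exact hgcl.preimage (vanishingIdeal (⟨Z, hZ⟩ : Closeds G)).subschemeι.continuous
    -- notation: `g = ι s`, `I = 𝓘⟨Z⟩_g`, `J = 𝓘⟨F⟩_g`
    set g : G := (vanishingIdeal (⟨Z, hZ⟩ : Closeds G)).subschemeι s with hg
    set I : Ideal (G.presheaf.stalk g) := stalkIdeal (vanishingIdeal (⟨Z, hZ⟩ : Closeds G)) g with hI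
    set J : Ideal (G.presheaf.stalk g) := stalkIdeal (vanishingIdeal (⟨F, hF⟩ : Closeds G)) g with hJdef
    -- `𝒪_{G,g}/𝓘⟨Z⟩_g = 𝒪_{Z̃,g}`: regular, a domain, of dimension one
    haveI hreg : IsRegularLocalRing (G.presheaf.stalk g ⧸ I) := isRegularLocalRing_stalk_quotient_stalkIdeal hZreg hgsupp
    haveI : IsDomain (G.presheaf.stalk g ⧸ I) := isDomain_of_isRegularLocalRing _
    have hdim : ringKrullDim (G.presheaf.stalk g ⧸ I) = 1 := by
      rw [hI, hg, ← ringKrullDim_stalk_subscheme]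
      exact_mod_cast hZdim s hsc
    refine ⟨?_, ne_maximalIdeal_of_ringKrullDim_quotient_eq_one hdim⟩
    -- (T1): the sum is `𝓘⟨F ∩ Z⟩_g`, radical and proper, and `J ⊄ I`
    have hJ : I ⊔ J = stalkIdeal (vanishingIdeal (⟨F ∩ Z, hF.inter hZ⟩ : Closeds G)) g := by
      rw [hI, hJdef, sup_comm, ← stalkIdeal_sup, htr]
    have hrad : (I ⊔ J).IsRadical := by
      rw [hJ]; exact isRadical_stalkIdeal_vanishingIdeal _ _
    have hne : I ⊔ J ≠ ⊤ := by
      rw [hJ]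
      have hmem : g ∈ (vanishingIdeal (⟨F ∩ Z, hF.inter hZ⟩ : Closeds G)).support := by
        rw [← SetLike.mem_coe, Scheme.IdealSheafData.coe_support_vanishingIdeal]; exact ⟨hgF, hgZ⟩
      have hle := (mem_support_iff_stalkIdeal_le _ _).mp hmem
      exact fun h => (IsLocalRing.maximalIdeal.isMaximal _).ne_top (top_le_iff.mp (h ▸ hle))
    exact sup_eq_maximalIdeal_of_isRadical_of_not_le hdim.le (hnc _ hgZ hgcl) hrad hne
  -- (B) every crossing point is closed
  have hclosed : ∀ g ∈ Z ∩ F, IsClosed ({g} : Set G) := by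
    rintro g ⟨hgZ, hgF⟩
    obtain ⟨z, hgz, hzcl⟩ := exists_specializes_isClosed g
    have hzZ : z ∈ Z := hgz.mem_closed hZ hgZ
    have hzF : z ∈ F := hgz.mem_closed hF hgF
    obtain ⟨hT1z, -⟩ := key z ⟨hzZ, hzF⟩ hzcl
    have h1 : stalkIdeal (vanishingIdeal (⟨Z, hZ⟩ : Closeds G)) z ≤ primeOfSpecializes hgz := stalkIdeal_vanishingIdeal_le hgz hgZ
    have h2 : stalkIdeal (vanishingIdeal (⟨F, hF⟩ : Closeds G)) z ≤ primeOfSpecializes hgz := stalkIdeal_vanishingIdeal_le hgz hgF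
    have hm : maximalIdeal (G.presheaf.stalk z) ≤ primeOfSpecializes hgz := hT1z ▸ sup_le h1 h2
    have hzg : z ⤳ g :=
      specializes_of_primeOfSpecializes_le hgz (specializes_refl z) (by rw [primeOfSpecializes_refl]; exact hm)
    have hgz' : g = z := by
      have h := hzg.mem_closure
      rw [hzcl.closure_eq, Set.mem_singleton_iff] at h
      exact h
    rw [hgz']; exact hzcl
  exact ⟨fun g hg => (key g hg (hclosed g hg)).1, fun g hg => (key g hg (hclosed g hg)).2, hclosed⟩

/-! ## (CL) with the model explicit, and verbatim -/

section CrossedLetter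

variable (k : Type) [Field k] (O : Type) [CommRing O] [IsDomain O] [IsDiscreteValuationRing O] (θ : O →+* k)

/-- **(CL) with the MODEL EXPLICIT — a crossed letter steps to its strict transform** (res-L1-w45b-stub-2's INPUT SPEC (IN-4)): the five `LetterDatum` clauses of
the new letter `closure υ₂⁻¹(cl L ∖ Z)` for the model `strictTransformIdeal τ C 𝓛`, from the letter's model `𝓛` and (CL)'s downstairs clauses (see the module
docstring for the hypotheses and the proof). [cite: GortzWedhorn2020, Prop. 13.91 and (13.19)] [cite: Matsumura1987, Thm. 14.2] [cite: StacksProject, Tag 01J7]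
[OURS · L1 W4.5b · WIDTH TABLE D5, supplier row HPAIR (CL)] -/
theorem TCPlus.crossedLetter_clauses (hθ : Function.Surjective θ) {P X X₂ G G₂ : Scheme.{0}} (q : P ⟶ Spec (.of O)) (Y : Set P) (σ : X ⟶ P)
    [IsLocallyNoetherian X] [IsIntegral X] [IsLocallyNoetherian X₂] [IsLocallyNoetherian G] [IsIntegral G₂] [IsProper (σ ≫ q)]
    (hX : Scheme.IsRegular X) (hX₂ : Scheme.IsRegular X₂)
    (jG : G ⟶ X) (tG : G ⟶ Spec (.of k)) (hsq : IsPullback jG tG (σ ≫ q) (Spec.map (CommRingCat.ofHom θ)))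
    -- the centre: regular, `O`-flat, `≠ ⊥`, reduced trace `𝓘⟨Z⟩`; `Z̃` regular with one-dimensional local rings at its closed points
    (C : X.IdealSheafData) {Z : Set G} (hZ : IsClosed Z) (hCZ : C.comap jG = vanishingIdeal ⟨Z, hZ⟩) (hCfl : Flat (C.subschemeι ≫ σ ≫ q))
    (hCreg : Scheme.IsRegular C.subscheme) (hC0 : C ≠ ⊥)
    (hZreg : ∀ z : ↥(AlgebraicGeometry.Scheme.IdealSheafData.vanishingIdeal (⟨Z, hZ⟩ : TopologicalSpace.Closeds G)).subscheme, IsRegularLocalRing ((AlgebraicGeometry.Scheme.IdealSheafData.vanishingIdeal (⟨Z, hZ⟩ : TopologicalSpace.Closeds G)).subscheme.presheaf.stalk z))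
    (hZdim : ∀ z : ↥(AlgebraicGeometry.Scheme.IdealSheafData.vanishingIdeal (⟨Z, hZ⟩ : TopologicalSpace.Closeds G)).subscheme, IsClosed ({z} : Set ↥(AlgebraicGeometry.Scheme.IdealSheafData.vanishingIdeal (⟨Z, hZ⟩ : TopologicalSpace.Closeds G)).subscheme) → ringKrullDim ((AlgebraicGeometry.Scheme.IdealSheafData.vanishingIdeal (⟨Z, hZ⟩ : TopologicalSpace.Closeds G)).subscheme.presheaf.stalk z) = ((1 : ℕ) : WithBot ℕ∞))
    -- the round upstairs and downstairs, the new model square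
    {τ : X₂ ⟶ X} (hτ : IsBlowup τ C) {υ₂ : G₂ ⟶ G} (hυ₂ : IsBlowup υ₂ (vanishingIdeal ⟨Z, hZ⟩))
    (j₂ : G₂ ⟶ X₂) (t₂ : G₂ ⟶ Spec (.of k)) (hsq₂ : IsPullback j₂ t₂ ((τ ≫ σ) ≫ q) (Spec.map (CommRingCat.ofHom θ))) (hcomm : j₂ ≫ τ = υ₂ ≫ jG)
    -- the letter with its model made explicit, crossed by the centre
    (L : Set G) (𝓛 : X.IdealSheafData) (hl1 : 𝓛.comap jG = vanishingIdeal ⟨closure L, isClosed_closure⟩)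
    (hl2 : ∀ z : X, (stalkIdeal 𝓛 z).IsPrincipal) (hl3 : Scheme.IsRegular 𝓛.subscheme)
    (hl4 : σ '' (𝓛.support : Set X) ⊆ {p : P | ¬ IsGenericPoint p Y}) (hl5 : Flat (𝓛.subschemeι ≫ σ ≫ q))
    (htr : vanishingIdeal (⟨closure L, isClosed_closure⟩ : Closeds G) ⊔ vanishingIdeal (⟨Z, hZ⟩ : Closeds G) =
      vanishingIdeal (⟨closure L ∩ Z, isClosed_closure.inter hZ⟩ : Closeds G))
    (hnc : ∀ z ∈ Z, IsClosed ({z} : Set G) →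
      ¬ stalkIdeal (vanishingIdeal (⟨closure L, isClosed_closure⟩ : Closeds G)) z ≤ stalkIdeal (vanishingIdeal (⟨Z, hZ⟩ : Closeds G)) z) :
    (strictTransformIdeal τ C 𝓛).comap j₂ = vanishingIdeal (⟨closure (υ₂ ⁻¹' (closure L \ Z)), isClosed_closure⟩ : Closeds G₂) ∧
      (∀ z : X₂, (stalkIdeal (strictTransformIdeal τ C 𝓛) z).IsPrincipal) ∧
      Scheme.IsRegular (strictTransformIdeal τ C 𝓛).subscheme ∧
      (τ ≫ σ) '' ((strictTransformIdeal τ C 𝓛).support : Set X₂) ⊆ {p : P | ¬ IsGenericPoint p Y} ∧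
      Flat ((strictTransformIdeal τ C 𝓛).subschemeι ≫ (τ ≫ σ) ≫ q) := by
  classical
  haveI : IsClosedImmersion (Spec.map (CommRingCat.ofHom θ)) := IsClosedImmersion.spec_of_surjective _ hθ
  haveI hjci : IsClosedImmersion jG := MorphismProperty.IsStableUnderBaseChange.of_isPullback hsq.flip inferInstance
  haveI : CompactSpace X := QuasiCompact.compactSpace_of_compactSpace (σ ≫ q)
  haveI : CompactSpace G := QuasiCompact.compactSpace_of_compactSpace jG
  -- (l-ii), (l-iv), (l-v) hold for the strict transform of any hypersurface model
  have hl2' : ∀ z : X₂, (stalkIdeal (strictTransformIdeal τ C 𝓛) z).IsPrincipal := fun z =>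
    isPrincipal_stalkIdeal_strictTransformIdeal hX hCreg hτ hC0 𝓛 hl2 z
  have hl4' : (τ ≫ σ) '' ((strictTransformIdeal τ C 𝓛).support : Set X₂) ⊆ {p : P | ¬ IsGenericPoint p Y} := by
    rintro _ ⟨z, hz, rfl⟩
    exact hl4 ⟨τ z, apply_mem_support_of_mem_support_strictTransformIdeal 𝓛 hz, (Scheme.Hom.comp_apply τ σ z).symm⟩
  have hl5' : Flat ((strictTransformIdeal τ C 𝓛).subschemeι ≫ (τ ≫ σ) ≫ q) :=
    flat_strictTransform_subschemeι_comp_stage O σ q τ C hτ 𝓛 hl5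
  by_cases h0 : 𝓛 = ⊥
  · -- the degenerate model: `cl L = G`, hence `Z = ∅` (no closed point of `Z` survives `hnc`), and `St_C ⊥ = ⊥`
    subst h0
    have hLuniv : closure L = Set.univ := by
      have h := congrArg (fun I : G.IdealSheafData => ((I.support : Closeds G) : Set G)) hl1
      simp only [Scheme.IdealSheafData.comap_bot, Scheme.IdealSheafData.support_bot, Closeds.coe_top,
        Scheme.IdealSheafData.coe_support_vanishingIdeal] at h
      exact h.symm
    have hZe : Z = ∅ := by
      by_contra hne
      obtain ⟨z, hz, hzcl⟩ := hZ.exists_closed_singleton (Set.nonempty_iff_ne_empty.mpr hne)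
      apply hnc z hz hzcl
      rw [← hl1, Scheme.IdealSheafData.comap_bot]
      have hb : stalkIdeal (⊥ : G.IdealSheafData) z = ⊥ := by
        obtain ⟨U, hU, hzU, -⟩ := exists_isAffineOpen_mem_and_subset (X := G) (x := z) (U := ⊤) (Opens.mem_top z)
        rw [stalkIdeal_eq_map_germ _ ⟨U, hU⟩ hzU, Scheme.IdealSheafData.ideal_bot, Pi.bot_apply, Ideal.map_bot]
      rw [hb]; exact bot_le
    have hSt : strictTransformIdeal τ C (⊥ : X.IdealSheafData) = ⊥ := strictTransformIdeal_bot hτ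
    refine ⟨?_, hl2', ?_, hl4', hl5'⟩
    · rw [hSt, Scheme.IdealSheafData.comap_bot]
      have hset : closure (υ₂ ⁻¹' (closure L \ Z)) = Set.univ := by
        rw [hLuniv, hZe, Set.sdiff_empty, Set.preimage_univ, closure_univ]
      have htop : (⟨closure (υ₂ ⁻¹' (closure L \ Z)), isClosed_closure⟩ : Closeds G₂) = ⊤ := Closeds.ext hset
      rw [htop, vanishingIdeal_top, Scheme.nilradical_eq_bot]
    · rw [hSt]
      haveI : IsIso (⊥ : X₂.IdealSheafData).subschemeι := (Scheme.isIso_subschemeι_iff_eq_bot _).mpr rfl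
      exact Scheme.IsRegular.of_isOpenImmersion (⊥ : X₂.IdealSheafData).subschemeι hX₂
  · -- the crossed letter: (T1)/(T2) by the bridge, snc by (A′-1), regularity by (A′-2), the trace by (A′-3)
    obtain ⟨hT1, hT2, -⟩ := crossing_stalkwise_of_curve_trace hZ isClosed_closure hZreg hZdim htr hnc
    have hE : HasSNCWith [𝓛] C := hasSNCWith_member_centre_of_trace_transversal hX hsq hθ hCZ hCreg hl1 hl2 hl3 h0 hT1 hT2
    exact ⟨comap_strictTransformIdeal_eq_vanishingIdeal_of_transversal' hsq hθ hτ hυ₂ hcomm hsq₂ hCZ hCfl hT1 hT2 hl1 hE, hl2',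
      isRegular_subscheme_strictTransformIdeal_of_hasSNCWith hE hτ, hl4', hl5'⟩

/-- **(CL) A CROSSED LETTER STEPS TO ITS STRICT TRANSFORM** — the (CL) hypothesis of ✓ `TCPlus.hpair_supplier_of` (p670305), VERBATIM: a listed letter NOT
containing the round's centre and meeting it transversally (possibly not at all) carries a `TCPlus.LetterDatum` at the new stage, with model the strict transform
of its model (`TCPlus.crossedLetter_clauses`). [cite: GortzWedhorn2020, Prop. 13.91 and (13.19)] [cite: Matsumura1987, Thm. 14.2]
[OURS · L1 W4.5b · WIDTH TABLE D5, supplier row HPAIR (CL)] -/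
theorem TCPlus.crossedLetter_transport :
    ∀ (O : Type) [CommRing O] [IsDomain O] [IsDiscreteValuationRing O] (θ : O →+* k), Function.Surjective θ →
      ∀ {P X X₂ G G₂ : AlgebraicGeometry.Scheme.{0}} (q : P ⟶ AlgebraicGeometry.Spec (.of O)) (Y : Set P) (σ : X ⟶ P)
        [IsLocallyNoetherian X] [AlgebraicGeometry.IsIntegral X] [IsLocallyNoetherian X₂] [AlgebraicGeometry.IsIntegral X₂]
        [IsLocallyNoetherian G] [AlgebraicGeometry.IsIntegral G] [IsLocallyNoetherian G₂] [AlgebraicGeometry.IsIntegral G₂] [AlgebraicGeometry.IsProper (σ ≫ q)],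
        Literature.AlgebraicGeometry.Resolution.Scheme.IsRegular X → Literature.AlgebraicGeometry.Resolution.Scheme.IsRegular X₂ →
      ∀ (jG : G ⟶ X) (tG : G ⟶ AlgebraicGeometry.Spec (.of k)), IsPullback jG tG (σ ≫ q) (AlgebraicGeometry.Spec.map (CommRingCat.ofHom θ)) →
      -- the centre: a regular `O`-flat relative curve with reduced trace `𝓘⟨Z⟩`, 2-frames, off `Y`; downstairs `Z̃` regular, a curve, `G` regular along `Z`
      ∀ (C : X.IdealSheafData) (Z : Set G) (hZ : IsClosed Z),
        C.comap jG = AlgebraicGeometry.Scheme.IdealSheafData.vanishingIdeal (⟨Z, hZ⟩ : TopologicalSpace.Closeds G) → AlgebraicGeometry.Flat (C.subschemeι ≫ σ ≫ q) →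
        Literature.AlgebraicGeometry.Resolution.Scheme.IsRegular C.subscheme → C ≠ ⊥ →
        (∀ x ∈ C.support, ∃ c : Fin 2 → X.presheaf.stalk x, Ideal.span (Set.range c) = Literature.AlgebraicGeometry.Resolution.stalkIdeal C x ∧ IsQuasiRegular c) →
        σ '' (C.support : Set X) ⊆ {p : P | ¬ IsGenericPoint p Y} →
        (∀ z : ↥(AlgebraicGeometry.Scheme.IdealSheafData.vanishingIdeal (⟨Z, hZ⟩ : TopologicalSpace.Closeds G)).subscheme, IsRegularLocalRing ((AlgebraicGeometry.Scheme.IdealSheafData.vanishingIdeal (⟨Z, hZ⟩ : TopologicalSpace.Closeds G)).subscheme.presheaf.stalk z)) →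
        (∀ z : ↥(AlgebraicGeometry.Scheme.IdealSheafData.vanishingIdeal (⟨Z, hZ⟩ : TopologicalSpace.Closeds G)).subscheme, IsClosed ({z} : Set ↥(AlgebraicGeometry.Scheme.IdealSheafData.vanishingIdeal (⟨Z, hZ⟩ : TopologicalSpace.Closeds G)).subscheme) → ringKrullDim ((AlgebraicGeometry.Scheme.IdealSheafData.vanishingIdeal (⟨Z, hZ⟩ : TopologicalSpace.Closeds G)).subscheme.presheaf.stalk z) = ((1 : ℕ) : WithBot ℕ∞)) →
        (∀ z ∈ Z, IsClosed ({z} : Set G) → IsRegularLocalRing (G.presheaf.stalk z)) →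
      -- the round upstairs and downstairs, the new model square
      ∀ {τ : X₂ ⟶ X}, Literature.AlgebraicGeometry.Resolution.IsBlowup τ C →
      ∀ {υ₂ : G₂ ⟶ G}, Literature.AlgebraicGeometry.Resolution.IsBlowup υ₂ (AlgebraicGeometry.Scheme.IdealSheafData.vanishingIdeal (⟨Z, hZ⟩ : TopologicalSpace.Closeds G)) →
      ∀ (j₂ : G₂ ⟶ X₂) (t₂ : G₂ ⟶ AlgebraicGeometry.Spec (.of k)), IsPullback j₂ t₂ ((τ ≫ σ) ≫ q) (AlgebraicGeometry.Spec.map (CommRingCat.ofHom θ)) → j₂ ≫ τ = υ₂ ≫ jG →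
      -- (CL) a listed letter NOT containing the centre and meeting it transversally (possibly not at all) steps to its strict transform
      ∀ (L : Set G), TCPlus.LetterDatum O P q Y G X σ jG L →
        AlgebraicGeometry.Scheme.IdealSheafData.vanishingIdeal (⟨closure L, isClosed_closure⟩ : TopologicalSpace.Closeds G) ⊔
            AlgebraicGeometry.Scheme.IdealSheafData.vanishingIdeal (⟨Z, hZ⟩ : TopologicalSpace.Closeds G) =
          AlgebraicGeometry.Scheme.IdealSheafData.vanishingIdeal (⟨closure L ∩ Z, isClosed_closure.inter hZ⟩ : TopologicalSpace.Closeds G) →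
        (∀ z ∈ Z, IsClosed ({z} : Set G) →
          ¬ Literature.AlgebraicGeometry.Resolution.stalkIdeal (AlgebraicGeometry.Scheme.IdealSheafData.vanishingIdeal (⟨closure L, isClosed_closure⟩ : TopologicalSpace.Closeds G)) z ≤
            Literature.AlgebraicGeometry.Resolution.stalkIdeal (AlgebraicGeometry.Scheme.IdealSheafData.vanishingIdeal (⟨Z, hZ⟩ : TopologicalSpace.Closeds G)) z) →
        TCPlus.LetterDatum O P q Y G₂ X₂ (τ ≫ σ) j₂ (closure (υ₂ ⁻¹' (closure L \ Z))) := by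
  intro O _ _ _ θ hθ P X X₂ G G₂ q Y σ _ _ _ _ _ _ _ _ _ hXreg hX₂reg jG tG hsq C Z hZ hCZ hCfl hCreg hC0 _ _ hZreg hZdim _ τ hτ υ₂ hυ₂ j₂ t₂ hsq₂ hcomm
    L hL htr hnc
  obtain ⟨𝓛, hl1, hl2, hl3, hl4, hl5⟩ := hL
  obtain ⟨h1, h2, h3, h4, h5⟩ := TCPlus.crossedLetter_clauses k O θ hθ q Y σ hXreg hX₂reg jG tG hsq C hZ hCZ hCfl hCreg hC0 hZreg hZdim hτ hυ₂ j₂ t₂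
    hsq₂ hcomm L 𝓛 hl1 hl2 hl3 hl4 hl5 htr hnc
  refine ⟨strictTransformIdeal τ C 𝓛, ?_, h2, h3, h4, h5⟩
  rw [h1]
  congr 1
  exact Closeds.ext closure_closure.symm

end CrossedLetter

end Summit.ResolutionOfSingularities.ResolutionOfSingularities.Cruxes.EquisingularLiftNat.Sections

end
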